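import Summits.BirchSwinnertonDyer.BirchSwinnertonDyer.Theorems.ErratumRoadFiveNonSurjCornerKolyJProp44LocalOrder
import Summits.BirchSwinnertonDyer.BirchSwinnertonDyer.Theorems.KolyvaginRoadThreeTowerFormPrintFree
import Summits.BirchSwinnertonDyer.Rank1Residual.X11b.RingClassFieldNoTorsionOfIrreducible
import Summits.BirchSwinnertonDyer.Rank1Residual.X11b.KolyvaginPointClassFixed
import Summits.BirchSwinnertonDyer.Rank1Residual.X11b.SplitPrimeUnramified
import Literature.NumberTheory.EllipticCurves.WeilPairingProofs
import HarnessLib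

/-!
# McCallum's standing inputs at a Zhang–Kolyvagin level DISCHARGED — `hPt` (Gross Prop. 3.6: `[P(n)]` is
# `Γ_K`-invariant mod `p^M`) for ANY concrete Kolyvagin–Heegner datum, and `hA` under (irr) — and Prop. 4.4
# «in particular» on the IRREDUCIBLE corner modulo (γ) ALONE (cell `bsd-stepL`, seat `bsd-stepL-corner-p1` g10;
# `--supports stmt-BirchSwinnertonDyer-19947`; memo CORNER-G10 §1)

WHY/WHAT. `Prop44.localOrder_kolyvaginClass_mul_eq_of_congruence` (…Prop44LocalOrder) is the BODY of the typed
print fact `McCallum1991.prop44_localOrder_kolyvaginClass_mul_eq` at `(W, K, p)`, image-free, modulo (γ) and McCallum's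
two standing inputs at the levels `m`, `mℓ`: `hA` (McCallum (5) ∕ Gross Lemma 4.3: `E(K[·]) ⊆ E(K̄)` admissible for
`p^M`) and `hPt` (McCallum (4) ∕ Gross Prop. 3.6: `[P(·)] ∈ (E(K_·)/p^M)^{𝒢}`). Here: (1) **`hPt` is a THEOREM for
every concrete datum at a Zhang–Kolyvagin level of index `≥ M`** (`toGeomPoints_derivedPoint_mem_invPoints`) — x11b3's
`KolyvaginH44.kolyvaginPoint_mem_invPoints_of_dvd` (X11b/KolyvaginPointClassFixed, Gross-keyed, family currency)
re-keyed to Zhang primes and to ONE datum: the auxiliary points `y(n/q)` needed by the trace relation Prop. 3.7 (1)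
(x11b3 `HeegnerTrace.*` on the tree's `prop37_1_traceRelation_holds`) are taken from koly's print-free existence
`nonempty_kolyvaginHeegnerData_printFree` (Gross §3, `grossCM_*_holds`), `p^M ∣ q + 1`, `p^M ∣ a_q` from Zhang's
index, "`G_n ≃ ∏ G_ℓ`" from `RingClassTower.ringClassGalOver_one_le_iSup`, the algebra from
`KolyvaginEuler.smul_kolyvaginPoint_sub_mem`; (2) `hA` on the irreducible cell is x11b3's
`NoTorsionIrr.isAdmissible_pointsSubgroup_of_hasIrreducibleModPGaloisRep` (with the PROVED Weil pairing and `p`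
unramified in `K` from `SatisfiesHeegnerHypothesis p K`); (3) hence **`localOrder_kolyvaginClass_mul_eq_of_congruence_of_irr`**
and the `h47`-currency `addOrderOf_localization_kolyvaginClass_mul_eq_of_congruence_of_irr`: McCallum Prop. 4.4 «in
particular» at Zhang–Kolyvagin levels for `E[p]` IRREDUCIBLE (no surjectivity), modulo the ONE print input (γ) =
Gross Prop. 3.7 (2) for the pair. HONEST FRAMING: conditional on (γ) only (PRINT, image-free); nothing about BSD; no
stub closes; T7. References: [McCallumLMS1991] §4 (4), (5), Lemma 4.3, Prop. 4.4 (p. 299–302); [GrossLMS1991] §3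
(3.3)–(3.5), Prop. 3.6, Prop. 3.7 (1)(2), §4 (4.1)–(4.2), Lemma 4.3; [WZhang2014] Notations (xii).
-/

set_option autoImplicit false
set_option linter.dupNamespace false

noncomputable section

open scoped Classical
open WeierstrassCurve Field NumberField IsDedekindDomain Finset
open Literature.NumberTheory.EllipticCurves Literature.NumberTheory.GaloisRepresentations
open Literature.NumberTheory.EllipticCurves.KolyvaginCocycle
open Literature.NumberTheory.EllipticCurves.KolyvaginEuler
open Literature.NumberTheory.EllipticCurves.RingClassField
open Literature.NumberTheory.EllipticCurves.ModularForms
open Literature.NumberTheory.GaloisCohomology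
open Summit.BirchSwinnertonDyer.Rank1Residual.X11b
open Summit.BirchSwinnertonDyer.Rank1Residual.X11b.KolyvaginH44
open Summit.BirchSwinnertonDyer.Rank1Residual.X11b.Three.Koly

namespace Summit.BirchSwinnertonDyer.BirchSwinnertonDyer.Theorems.Prop44

-- `K : Type`: the tree's ring-class class field theory is universe `0`.
variable {K : Type} [Field K] [NumberField K] {W : WeierstrassCurve ℚ} [W.IsElliptic] [W.IsGloballyMinimal]
  [NeZero (W.conductorNorm ℤ)]

/-! ## §1 `hPt`: `[P(n)] ∈ (E(K[n])/p^M)^{𝒢_n}` for every concrete datum at a Zhang–Kolyvagin level -/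

set_option maxHeartbeats 800000 in
/-- **McCallum (4) ∕ Gross Prop. 3.6 at a Zhang–Kolyvagin level, for ANY concrete datum** — the standing input `hPt` of
McCallum's class: for `K` imaginary quadratic with `d_K < −4` and the Heegner hypothesis for `N_E`, a frame
`(Dt, β, ι)`, `p` prime, any `M`, `n` square-free with Zhang–Kolyvagin prime factors of index `≥ M`, and
`d : KolyvaginHeegnerData Dt β ι n`: the image of `P(n)` in `E(K̄)` lies in `invPoints Γ_K E(K[n]) p^M`, i.e.
`γ P(n) − P(n) ∈ p^M E(K[n])` for all `γ ∈ Γ_K` (*"By Proposition 3.6, the class `[P_n]` in `E(K_n)/pE(K_n)` is fixed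
by `𝒢_n`"*). [cite: GrossLMS1991, Prop. 3.6, Prop. 3.7 (1), §3 (3.3)–(3.5), §4 (4.1)] [cite: McCallumLMS1991, §4 (4)]
[cite: WZhang2014, Notations (xii)] -/
theorem toGeomPoints_derivedPoint_mem_invPoints (hK : IsImaginaryQuadratic K) (ι : K →+* ℂ)
    (hD : NumberField.discr K < -4) (hH : SatisfiesHeegnerHypothesis (W.conductorNorm ℤ) K)
    (Dt : ModularParametrizationData W (W.conductorNorm ℤ)) {β : ℤ} {p M : ℕ} (hp : p.Prime)
    {n : ℕ} (hn : Squarefree n)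
    (hkol : ∀ q ∈ n.primeFactors, Zhang2014.IsKolyvaginPrime (W.conductorNorm ℤ) W K p q ∧
      M ≤ Zhang2014.kolyvaginIndex W p q)
    (d : KolyvaginHeegnerData Dt β ι n) :
    d.toGeomPoints d.derivedPoint ∈ invPoints (absoluteGaloisGroup K) d.pointsSubgroup ((p ^ M : ℕ) : ℤ) := by
  letI : Algebra K ℂ := ι.toAlgebra
  haveI : Fact p.Prime := ⟨hp⟩
  set N : ℕ := W.conductorNorm ℤ with hNdef
  have hn0 : n ≠ 0 := Squarefree.ne_zero hn
  have hinert : ∀ q ∈ n.primeFactors, (Ideal.span {(q : 𝓞 K)}).IsPrime :=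
    fun q hq ↦ (hkol q hq).1.2.2.2.2.1
  have hND : IsCoprime (N : ℤ) (NumberField.discr K) :=
    KolyvaginAssembly.isCoprime_discr_of_satisfiesHeegnerHypothesis hK hH
  have hNn : Nat.Coprime N n :=
    KolyvaginH37Bridge.coprime_of_forall_not_dvd hn0 fun q hq ↦ (hkol q hq).1.2.1
  -- the level data of `d`
  obtain ⟨σ, H, f, y, π, j, e, hord, hj, -, hfsec, hHρ, hdict, -⟩ :=
    exists_levelData_of (W := W) (Dt := Dt) (β := β) hK ι (fun k ↦ k = n) (fun k (hk : k = n) ↦ hk ▸ hn)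
      (fun k (hk : k = n) ↦ hk ▸ hinert) (fun k (hk : k = n) ↦ hk ▸ d) n
  obtain ⟨hjd, hyd, hσd, hfS⟩ := hdict rfl
  letI hcg : CommGroup (ringClassGal ι n) :=
    { (inferInstance : Group (ringClassGal ι n)) with
      mul_comm := fun a b ↦ (isMulCommutative_ringClassGal' hK ι n).is_comm.comm a b }
  haveI hfin : Finite (ringClassGal ι n) := finite_ringClassGal hK ι n
  letI act : DistribMulAction (ringClassGal ι n) ((W.baseChange (ringClassField K ι n)).toAffine.Point) :=
    DistribMulAction.compHom _ ((pointGalHom W (ringClassField K ι n)).comp (ringClassGal ι n).subtype)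
  letI hft : Fintype (ringClassGal ι n ⧸ H) := Fintype.ofFinite _
  set ρ : ringClassGal ι n →* (ringClassField K ι n ≃ₐ[ℚ] ringClassField K ι n) :=
    (ringClassGal ι n).subtype with hρdef
  have hρ : Function.Injective ρ := (ringClassGal ι n).subtype_injective
  have hsmul : ∀ (g : ringClassGal ι n) (Q : (W.baseChange (ringClassField K ι n)).toAffine.Point),
      g • Q = pointGalHom W (ringClassField K ι n) (ρ g) Q := fun _ _ ↦ rfl
  have hj' : ∀ (g : absoluteGaloisGroup K) (a : (W.baseChange (ringClassField K ι n)).toAffine.Point),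
      j (π g • a) = g • j a := fun g a ↦ by rw [hsmul]; exact hj g a
  have hσq : ∀ q ∈ n.primeFactors, ρ (σ q) = d.σ q := fun q hq ↦ hσd q hq
  -- the abstract Kolyvagin point is `P(n)` (x11b3-p8's G1)
  have hbij : Set.BijOn (fun c : ringClassGal ι n ⧸ H ↦ ρ (f c)) Set.univ (d.S : Set _) :=
    KolyvaginH37Bridge.bijOn_of_section_of_transversal ρ hρ (H := H) (Γ := ringClassGal ι n)
      (G₁ := ringClassGalOver ι n 1) hHρ (S := (d.S : Set _)) (fun s hs ↦ d.S_subset s hs)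
      (fun s hs ↦ ⟨⟨s, d.S_subset s hs⟩, rfl⟩) d.S_transversal f hfsec hfS
  have hP : j (kolyvaginPoint σ n.primeFactors f y) = d.toGeomPoints d.derivedPoint := by
    rw [hjd, hyd]
    congr 1
    exact KolyvaginH37Bridge.map_kolyvaginPoint_eq_derivedPoint (pointGalHom W (ringClassField K ι n)) ρ
      (AddMonoidHom.id _) (fun g a ↦ hsmul g a) hn hσq f hbij d.y
  -- McCallum's (4): `γ P(n) − P(n) ∈ p^M E(K[n])` for every `γ ∈ 𝒢_n`
  have h4 : ∀ γ : ringClassGal ι n,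
      γ • kolyvaginPoint σ n.primeFactors f y - kolyvaginPoint σ n.primeFactors f y ∈
        zsmulRange ((W.baseChange (ringClassField K ι n)).toAffine.Point) ((p ^ M : ℕ) : ℤ) := by
    refine smul_kolyvaginPoint_sub_mem hfsec ?_ (fun q hq ↦ hord q hq) (fun q hq ↦ ?_) (fun q hq ↦ ?_)
    · -- `hgen`: `G_n ≤ ⟨σ_q : q ∣ n⟩` ("`G_n ≃ ∏ G_ℓ`")
      intro h hh
      have h1 := RingClassTower.ringClassGalOver_one_le_iSup hK ι hn (hHρ h hh)
      have h2 : (⨆ q ∈ n.primeFactors, ringClassGalOver ι n (n / q)) ≤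
          (Subgroup.closure (σ '' (n.primeFactors : Set ℕ))).map ρ := by
        refine iSup₂_le fun q hq ↦ ?_
        rw [← d.zpowers_σ q hq, ← hσq q hq, ← MonoidHom.map_zpowers]
        exact Subgroup.map_mono (Subgroup.zpowers_le.mpr
          (Subgroup.subset_closure ⟨q, Finset.mem_coe.mpr hq, rfl⟩))
      obtain ⟨g, hg, hgh⟩ := Subgroup.mem_map.mp (h2 h1)
      rwa [← hρ hgh]
    · -- `p^M ∣ q + 1`
      obtain ⟨h1, -⟩ := Zhang2014.le_kolyvaginIndex_iff.mp (hkol q (Finset.mem_coe.mp hq)).2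
      exact_mod_cast h1
    · -- `Tr_q y(n) ∈ p^M E(K[n])`: Prop. 3.7 (1) with an auxiliary `y(n/q)`, and `p^M ∣ a_q`
      have hq' : q ∈ n.primeFactors := Finset.mem_coe.mp hq
      obtain ⟨hqp, hqn, -⟩ := Nat.mem_primeFactors.mp hq'
      haveI : Fact q.Prime := ⟨hqp⟩
      have hqn' : ¬ q ∣ n / q := not_dvd_div_of_squarefree_of_prime hn hqp hqn
      have hle : ringClassField K ι (n / q) ≤ ringClassField K ι n :=
        ringClassField_mono hK ι (Nat.div_dvd_of_dvd hqn) hn0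
      obtain ⟨dq⟩ := nonempty_kolyvaginHeegnerData_printFree hK hH Dt β ι d.dvd_sq_sub
        (hn.squarefree_of_dvd (Nat.div_dvd_of_dvd hqn))
        (fun r hr ↦ hinert r (Nat.primeFactors_mono (Nat.div_dvd_of_dvd hqn) hn0 hr))
      have hgood : W.HasGoodReductionAtPrime q :=
        KolyvaginH37Bridge.hasGoodReductionAtPrime_of_modularParametrizationData Dt (hkol q hq').1.2.1
      have htr := HeegnerTrace.frobeniusTrace_smul_eq_of_lFunction_smul_eq hgood
        (HeegnerTrace.sum_pow_pointGalHom_y_eq_lFunction_smul_map hK ι hND hq' (hinert q hq') (hkol q hq').1.2.1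
          hqn' hNn (Or.inr hD) d dq hle)
      have haq : ((p ^ M : ℕ) : ℤ) ∣ W.frobeniusTrace q := by
        obtain ⟨-, h2⟩ := Zhang2014.le_kolyvaginIndex_iff.mp (hkol q hq').2
        exact_mod_cast h2
      refine grAct_traceElt_mem_of_eq_smul
        (y' := WeierstrassCurve.Affine.Point.map (W' := W) ((RingClassField.inclusion ι hle).restrictScalars ℚ) dq.y)
        ?_ haq
      rw [grAct_traceElt]
      simp_rw [hsmul, map_pow ρ, hσq q hq', hyd]
      exact htr
  have h := map_mem_invPoints_of_forall_smul_sub_mem π j hj' h4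
  rw [hP, hjd] at h
  exact h

/-! ## §2 Prop. 4.4 «in particular» on the irreducible cell, modulo (γ) alone -/

/-- **McCallum Prop. 4.4 «in particular» for `E[p]` IRREDUCIBLE, modulo (γ) ALONE** — the BODY of
`McCallum1991.prop44_localOrder_kolyvaginClass_mul_eq` at `(W, K, p)` with NO image hypothesis beyond irreducibility of
`E[p]`: `K` imaginary quadratic, `d_K ∉ {−3, −4}`, Heegner hypothesis for `N_E`, `p` odd splitting in `K`
(`SatisfiesHeegnerHypothesis p K`, as on the corner frames; only "unramified" is used), `ρ̄_{E,p}` irreducible; then for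
every frame, level `M ≥ 1`, compatible data at `m`, `mℓ` (Zhang–Kolyvagin prime factors of index `≥ M`) and (γ) for
the pair: at `λ ∋ ℓ`, `∀ j`, `p^j c_M(mℓ) ∈ Sel_λ ↔ p^j c_M(mℓ)_λ = 0` and `p^j c_M(mℓ)_λ = 0 ↔ p^j c_M(m)_λ = 0`.
(`hA` by x11b3's `NoTorsionIrr.isAdmissible_pointsSubgroup_of_hasIrreducibleModPGaloisRep` + the proved Weil pairing;
`hPt` by §1.) [cite: McCallumLMS1991, §4 Prop. 4.4 «In particular» (p. 301), (4), (5)] [cite: GrossLMS1991, Prop.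
3.6, Prop. 3.7 (1)(2), Lemma 4.3] [cite: WZhang2014, Notations (xii)] -/
theorem localOrder_kolyvaginClass_mul_eq_of_congruence_of_irr (hK : IsImaginaryQuadratic K)
    (hD3 : NumberField.discr K ≠ -3) (hD4 : NumberField.discr K ≠ -4)
    (hH : SatisfiesHeegnerHypothesis (W.conductorNorm ℤ) K) {p : ℕ} [Fact p.Prime] (hp2 : p ≠ 2)
    (hHp : SatisfiesHeegnerHypothesis p K) (hirr : W.HasIrreducibleModPGaloisRep p)
    (Dt : ModularParametrizationData W (W.conductorNorm ℤ)) (β : ℤ) (ι : K →+* ℂ) (M : ℕ) (hM : 1 ≤ M)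
    (m l : ℕ) (hsq : Squarefree (m * l)) (hl : l.Prime) (hlm : ¬ l ∣ m)
    (hS : ∀ l' ∈ (m * l).primeFactors, Zhang2014.IsKolyvaginPrime (W.conductorNorm ℤ) W K p l' ∧
      M ≤ Zhang2014.kolyvaginIndex W p l')
    (d : KolyvaginHeegnerData Dt β ι m) (d' : KolyvaginHeegnerData Dt β ι (m * l))
    (hσ : ∀ l' ∈ m.primeFactors, ∀ (x : ringClassField K ι m) (x' : ringClassField K ι (m * l)),
      (x : ℂ) = x' → ((d'.σ l' x' : ringClassField K ι (m * l)) : ℂ) = (d.σ l' x : ℂ))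
    (hS₁ : ∀ s ∈ d.S, ∃ s' ∈ d'.S, ∀ (x : ringClassField K ι m) (x' : ringClassField K ι (m * l)),
      (x : ℂ) = x' → ((s' x' : ringClassField K ι (m * l)) : ℂ) = (s x : ℂ))
    (hS₂ : ∀ s' ∈ d'.S, ∃ s ∈ d.S, ∀ (x : ringClassField K ι m) (x' : ringClassField K ι (m * l)),
      (x : ℂ) = x' → ((s' x' : ringClassField K ι (m * l)) : ℂ) = (s x : ℂ))
    (hemb : ∀ (x : ringClassField K ι m) (x' : ringClassField K ι (m * l)),
      (x : ℂ) = x' → d'.emb x' = d.emb x)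
    (hγ : ∀ [Fact l.Prime] (hΔ : ¬ (l : ℤ) ∣ minimalDiscriminantInt W)
      (φ₀ : absoluteGaloisGroup (ZMod l)), (∀ x : AlgebraicClosure (ZMod l), φ₀ • x = x ^ l) →
      ∀ (hle : ringClassField K ι m ≤ ringClassField K ι (m * l))
        (γ : ringClassField K ι (m * l) ≃ₐ[ℚ] ringClassField K ι (m * l)), γ ∈ ringClassGal ι (m * l) →
        geomReduction hΔ ((RatClosure.pointsEquiv (K := K) W).symm
            (d'.toGeomPoints (pointGalHom W (ringClassField K ι (m * l)) γ d'.y))) =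
          φ₀ • geomReduction hΔ ((RatClosure.pointsEquiv (K := K) W).symm
            (d'.toGeomPoints (pointGalHom W (ringClassField K ι (m * l)) γ
              (WeierstrassCurve.Affine.Point.map (W' := W)
                (letI : Algebra K ℂ := ι.toAlgebra; (RingClassField.inclusion ι hle).restrictScalars ℚ)
                d.y)))))
    (v : HeightOneSpectrum (𝓞 K)) (hv : (l : 𝓞 K) ∈ v.asIdeal) (j : ℕ) :
    (((p ^ j : ℕ) : ℤ) • d'.kolyvaginClass (Fact.out : p.Prime) M ∈
        selmerLocalKer (W.baseChange K) (v.adicCompletion K) ((p ^ M : ℕ) : ℤ) ↔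
      ((p ^ j : ℕ) : ℤ) • d'.kolyvaginClass (Fact.out : p.Prime) M ∈
        (W.baseChange K).torsionLocalKer (v.adicCompletion K) ((p ^ M : ℕ) : ℤ)) ∧
    (((p ^ j : ℕ) : ℤ) • d'.kolyvaginClass (Fact.out : p.Prime) M ∈
        (W.baseChange K).torsionLocalKer (v.adicCompletion K) ((p ^ M : ℕ) : ℤ) ↔
      ((p ^ j : ℕ) : ℤ) • d.kolyvaginClass (Fact.out : p.Prime) M ∈
        (W.baseChange K).torsionLocalKer (v.adicCompletion K) ((p ^ M : ℕ) : ℤ)) := by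
  have hp : p.Prime := Fact.out
  have hD : NumberField.discr K < -4 := KolyvaginAssembly.discr_lt_neg_four hK ⟨hD3, hD4⟩
  have hn0 : m * l ≠ 0 := hsq.ne_zero
  have hm0 : m ≠ 0 := fun h ↦ hn0 (by rw [h, zero_mul])
  have hl' : l ∈ (m * l).primeFactors := Nat.mem_primeFactors.mpr ⟨hl, dvd_mul_left l m, hn0⟩
  have hSm : ∀ q ∈ m.primeFactors, Zhang2014.IsKolyvaginPrime (W.conductorNorm ℤ) W K p q ∧
      M ≤ Zhang2014.kolyvaginIndex W p q :=
    fun q hq ↦ hS q (Nat.primeFactors_mono (dvd_mul_right m l) hn0 hq)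
  have hpml : ¬ p ∣ m * l := fun h ↦
    (hS p (Nat.mem_primeFactors.mpr ⟨hp, h, hn0⟩)).1.2.2.2.1 rfl
  have hpm : ¬ p ∣ m := fun h ↦ hpml (h.mul_right l)
  have hKunr : ∀ v : HeightOneSpectrum (𝓞 ℚ), (p : 𝓞 ℚ) ∈ v.asIdeal →
      Algebra.IsUnramifiedIn (𝓞 K) v.asIdeal :=
    isUnramifiedIn_of_satisfiesHeegnerHypothesis_of_dvd hK hHp hp (dvd_refl p)
  have hW : W.exists_weilPairing p := W.exists_weilPairing_holds p
  have hA : IsAdmissible (absoluteGaloisGroup K) d.pointsSubgroup ((p ^ M : ℕ) : ℤ) :=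
    NoTorsionIrr.isAdmissible_pointsSubgroup_of_hasIrreducibleModPGaloisRep d hK hm0 hp hp2 hirr hW hKunr hpm M
  have hA' : IsAdmissible (absoluteGaloisGroup K) d'.pointsSubgroup ((p ^ M : ℕ) : ℤ) :=
    NoTorsionIrr.isAdmissible_pointsSubgroup_of_hasIrreducibleModPGaloisRep d' hK hn0 hp hp2 hirr hW hKunr hpml M
  have hPt := toGeomPoints_derivedPoint_mem_invPoints hK ι hD hH Dt hp
    (hsq.squarefree_of_dvd (dvd_mul_right m l)) hSm d
  have hPt' := toGeomPoints_derivedPoint_mem_invPoints hK ι hD hH Dt hp hsq hS d'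
  exact localOrder_kolyvaginClass_mul_eq_of_congruence hK hD3 hD4 hH hp2 Dt β ι M hM m l hsq hl hlm hS d d' hσ hS₁
    hS₂ hemb hγ hA hA' hPt hPt' v hv j

/-- **The walk's `h47` on the irreducible cell, modulo (γ) alone** — `addOrderOf (loc_λ c_M(mℓ)) = addOrderOf
(loc_λ c_M(m))` for `E[p]` irreducible (no surjectivity), compatible data at Zhang–Kolyvagin levels, given (γ) for the
pair. [cite: Jetchev2008, Prop. 4.4 (p. 821) = arXiv Prop. 4.7] [cite: McCallumLMS1991, §4 Prop. 4.4 (p. 301)]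
[cite: GrossLMS1991, Prop. 3.7 (2)] -/
theorem addOrderOf_localization_kolyvaginClass_mul_eq_of_congruence_of_irr (hK : IsImaginaryQuadratic K)
    (hD3 : NumberField.discr K ≠ -3) (hD4 : NumberField.discr K ≠ -4)
    (hH : SatisfiesHeegnerHypothesis (W.conductorNorm ℤ) K) {p : ℕ} [Fact p.Prime] (hp2 : p ≠ 2)
    (hHp : SatisfiesHeegnerHypothesis p K) (hirr : W.HasIrreducibleModPGaloisRep p)
    (Dt : ModularParametrizationData W (W.conductorNorm ℤ)) (β : ℤ) (ι : K →+* ℂ) (M : ℕ) (hM : 1 ≤ M)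
    (m l : ℕ) (hsq : Squarefree (m * l)) (hl : l.Prime) (hlm : ¬ l ∣ m)
    (hS : ∀ l' ∈ (m * l).primeFactors, Zhang2014.IsKolyvaginPrime (W.conductorNorm ℤ) W K p l' ∧
      M ≤ Zhang2014.kolyvaginIndex W p l')
    (d : KolyvaginHeegnerData Dt β ι m) (d' : KolyvaginHeegnerData Dt β ι (m * l))
    (hσ : ∀ l' ∈ m.primeFactors, ∀ (x : ringClassField K ι m) (x' : ringClassField K ι (m * l)),
      (x : ℂ) = x' → ((d'.σ l' x' : ringClassField K ι (m * l)) : ℂ) = (d.σ l' x : ℂ))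
    (hS₁ : ∀ s ∈ d.S, ∃ s' ∈ d'.S, ∀ (x : ringClassField K ι m) (x' : ringClassField K ι (m * l)),
      (x : ℂ) = x' → ((s' x' : ringClassField K ι (m * l)) : ℂ) = (s x : ℂ))
    (hS₂ : ∀ s' ∈ d'.S, ∃ s ∈ d.S, ∀ (x : ringClassField K ι m) (x' : ringClassField K ι (m * l)),
      (x : ℂ) = x' → ((s' x' : ringClassField K ι (m * l)) : ℂ) = (s x : ℂ))
    (hemb : ∀ (x : ringClassField K ι m) (x' : ringClassField K ι (m * l)),
      (x : ℂ) = x' → d'.emb x' = d.emb x)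
    (hγ : ∀ [Fact l.Prime] (hΔ : ¬ (l : ℤ) ∣ minimalDiscriminantInt W)
      (φ₀ : absoluteGaloisGroup (ZMod l)), (∀ x : AlgebraicClosure (ZMod l), φ₀ • x = x ^ l) →
      ∀ (hle : ringClassField K ι m ≤ ringClassField K ι (m * l))
        (γ : ringClassField K ι (m * l) ≃ₐ[ℚ] ringClassField K ι (m * l)), γ ∈ ringClassGal ι (m * l) →
        geomReduction hΔ ((RatClosure.pointsEquiv (K := K) W).symm
            (d'.toGeomPoints (pointGalHom W (ringClassField K ι (m * l)) γ d'.y))) =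
          φ₀ • geomReduction hΔ ((RatClosure.pointsEquiv (K := K) W).symm
            (d'.toGeomPoints (pointGalHom W (ringClassField K ι (m * l)) γ
              (WeierstrassCurve.Affine.Point.map (W' := W)
                (letI : Algebra K ℂ := ι.toAlgebra; (RingClassField.inclusion ι hle).restrictScalars ℚ)
                d.y)))))
    (v : HeightOneSpectrum (𝓞 K)) (hv : (l : 𝓞 K) ∈ v.asIdeal) :
    addOrderOf ((galoisCohomology.localization
        ((W.baseChange K).torsionGaloisModule ((p ^ M : ℕ) : ℤ)) (Sum.inr v) 1 :
          galH1Torsion (W.baseChange K) ((p ^ M : ℕ) : ℤ) →+ _)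
        (d'.kolyvaginClass (Fact.out : p.Prime) M)) =
      addOrderOf ((galoisCohomology.localization
        ((W.baseChange K).torsionGaloisModule ((p ^ M : ℕ) : ℤ)) (Sum.inr v) 1 :
          galH1Torsion (W.baseChange K) ((p ^ M : ℕ) : ℤ) →+ _)
        (d.kolyvaginClass (Fact.out : p.Prime) M)) := by
  have hp : p.Prime := Fact.out
  have hD : NumberField.discr K < -4 := KolyvaginAssembly.discr_lt_neg_four hK ⟨hD3, hD4⟩
  have hn0 : m * l ≠ 0 := hsq.ne_zero
  have hm0 : m ≠ 0 := fun h ↦ hn0 (by rw [h, zero_mul])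
  have hSm : ∀ q ∈ m.primeFactors, Zhang2014.IsKolyvaginPrime (W.conductorNorm ℤ) W K p q ∧
      M ≤ Zhang2014.kolyvaginIndex W p q :=
    fun q hq ↦ hS q (Nat.primeFactors_mono (dvd_mul_right m l) hn0 hq)
  have hpml : ¬ p ∣ m * l := fun h ↦
    (hS p (Nat.mem_primeFactors.mpr ⟨hp, h, hn0⟩)).1.2.2.2.1 rfl
  have hpm : ¬ p ∣ m := fun h ↦ hpml (h.mul_right l)
  have hKunr : ∀ v : HeightOneSpectrum (𝓞 ℚ), (p : 𝓞 ℚ) ∈ v.asIdeal →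
      Algebra.IsUnramifiedIn (𝓞 K) v.asIdeal :=
    isUnramifiedIn_of_satisfiesHeegnerHypothesis_of_dvd hK hHp hp (dvd_refl p)
  have hW : W.exists_weilPairing p := W.exists_weilPairing_holds p
  have hA : IsAdmissible (absoluteGaloisGroup K) d.pointsSubgroup ((p ^ M : ℕ) : ℤ) :=
    NoTorsionIrr.isAdmissible_pointsSubgroup_of_hasIrreducibleModPGaloisRep d hK hm0 hp hp2 hirr hW hKunr hpm M
  have hA' : IsAdmissible (absoluteGaloisGroup K) d'.pointsSubgroup ((p ^ M : ℕ) : ℤ) :=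
    NoTorsionIrr.isAdmissible_pointsSubgroup_of_hasIrreducibleModPGaloisRep d' hK hn0 hp hp2 hirr hW hKunr hpml M
  have hPt := toGeomPoints_derivedPoint_mem_invPoints hK ι hD hH Dt hp
    (hsq.squarefree_of_dvd (dvd_mul_right m l)) hSm d
  have hPt' := toGeomPoints_derivedPoint_mem_invPoints hK ι hD hH Dt hp hsq hS d'
  exact addOrderOf_localization_kolyvaginClass_mul_eq_of_congruence hK hD3 hD4 hH hp2 Dt β ι M hM m l hsq hl hlm hS
    d d' hσ hS₁ hS₂ hemb hγ hA hA' hPt hPt' v hv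

end Summit.BirchSwinnertonDyer.BirchSwinnertonDyer.Theorems.Prop44

end
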